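import Literature.Probability.LatticeModels.MedialCycleSeparation
import Literature.Probability.LatticeModels.MedialTraversalSectors
import Literature.Probability.LatticeModels.SpinPolygonGeometry
import Literature.Probability.RandomPlanarGeometry.ExteriorULC
import Literature.Topology.PlaneTopology.JordanSweepParity
import HarnessLib

/-!
# Touch criterion, stub B: centres of non-inner faces have winding number zero

Topic: `Summits/CriticalPhenomena/CardyFormulaZ2`, crux `LagHandOff` (line hitting-tournament,
touch criterion, stub B). For a discrete Dobrushin structure `E` on a Jordan domain `Dm`
(`E.Ω = Dm.carrier`, `E.δ > 0`) and a cycle of the turning rule `nextCorner β` through `q` all of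
whose faces are inner, the closed perturbed polygon `cyLoop n h` (`MedialCycleSeparation.lean`,
lattice units) has winding number `0` about the centre of every non-inner face. Proof: the
polygon lies in the closed squares of the (inner) faces of the cycle, and the closed square of an
inner face lies in `δ⁻¹ • closure D`; so the open square of a non-inner face, the points at
sup-distance `< 1` from a lattice point outside `Ω_δ` (corners of inner faces lie in `Ω_δ`) and
the rescaled exterior `δ⁻¹ • (closure D)ᶜ` are off the polygon. The rescaled exterior is
preconnected (Jordan curve theorem), unbounded and off the polygon, so the winding number
vanishes on the complementary component of each of its points. A non-inner face has a side
`[v, w]` that is not an edge of `Ω_δ`: if an endpoint `v` is outside `Ω_δ`, walk from the centre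
to `v` and east along the lattice line, through lattice points outside `Ω_δ` (one mesh
component), until the mesh point leaves `D` (an exterior point is within `δ`) or the next lattice
edge leaves `closure D`; otherwise the side itself leaves `closure D` at a point joined to the
centre inside the open square of the face.
-/

noncomputable section

open Set Complex Literature.Topology.PlaneTopology
open Literature.Probability.Percolation Literature.Probability.LatticeModels
open Literature.Probability.RandomPlanarGeometry
open scoped Pointwise

namespace Summit.CriticalPhenomena.CardyFormulaZ2.Cruxes.LagHandOff.HittingTournament

/-! ### Lattice geometry: closed squares near a lattice point, rays inside a square -/

/-- A closed unit square containing a point at sup-distance `< 1` from the lattice point `v`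
has `v` as a corner. -/
theorem isCorner_of_mem_closedSq_of_near {g v : Site 2} {z : ℂ} (hz : z ∈ closedSq g)
    (hnear : ∀ k, |coordVec z k - v k| < 1) : IsCorner v g := by
  intro k
  obtain ⟨h1, h2⟩ := hz k
  obtain ⟨h3, h4⟩ := abs_lt.1 (hnear k)
  have h5 : g k < v k + 1 := by exact_mod_cast (show (g k : ℝ) < v k + 1 by linarith)
  have h6 : v k < g k + 2 := by exact_mod_cast (show (v k : ℝ) < g k + 2 by linarith)
  omega

/-- The segment from the centre of a face to a point of its closed square lies in the open
square, except possibly for its far endpoint. -/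
theorem mem_openSq_of_mem_segment_faceCenter {f : Site 2} {m z : ℂ} (hm : m ∈ closedSq f)
    (hz : z ∈ segment ℝ (faceCenter f) m) (hzm : z ≠ m) : z ∈ openSq f := by
  rw [mem_segment_iff_coordVec] at hz
  obtain ⟨t, ht0, ht1, hc⟩ := hz
  have ht1' : t < 1 := by
    refine lt_of_le_of_ne ht1 fun ht => hzm (eq_of_coordVec_eq fun k => ?_)
    rw [hc k, ht]; ring
  intro k
  rw [hc k, coordVec_faceCenter]
  obtain ⟨h1, h2⟩ := hm k
  constructor <;> nlinarith [mul_nonneg ht0 (sub_nonneg.2 h1), mul_nonneg ht0 (sub_nonneg.2 h2)]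

/-- The points at sup-distance `< 1` from a lattice point form a convex set: segments with both
endpoints near `v` stay near `v`. -/
theorem near_of_mem_segment {v : Site 2} {a b z : ℂ} (ha : ∀ k, |coordVec a k - v k| < 1)
    (hb : ∀ k, |coordVec b k - v k| < 1) (hz : z ∈ segment ℝ a b) :
    ∀ k, |coordVec z k - v k| < 1 := by
  rw [mem_segment_iff_coordVec] at hz
  obtain ⟨t, ht0, ht1, hc⟩ := hz
  intro k
  obtain ⟨h1, h2⟩ := abs_lt.1 (ha k)
  obtain ⟨h3, h4⟩ := abs_lt.1 (hb k)
  rw [hc k, abs_lt]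
  rcases eq_or_lt_of_le ht1 with rfl | ht1'
  · constructor <;> linarith
  · constructor <;> nlinarith [mul_pos (sub_pos.2 ht1') (by linarith : (0 : ℝ) < coordVec a k - v k + 1),
      mul_nonneg ht0 (by linarith : (0 : ℝ) ≤ coordVec b k - v k + 1),
      mul_pos (sub_pos.2 ht1') (by linarith : (0 : ℝ) < 1 - (coordVec a k - v k)),
      mul_nonneg ht0 (by linarith : (0 : ℝ) ≤ 1 - (coordVec b k - v k))]

/-- The centre of a face is near each of its corners. -/
theorem near_faceCenter {v f : Site 2} (hv : IsCorner v f) :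
    ∀ k, |coordVec (faceCenter f) k - v k| < 1 := fun k => by
  rw [coordVec_faceCenter, abs_lt]
  rcases hv.coord_cases k with ⟨-, h⟩ | ⟨-, h⟩ <;> rw [h] <;> constructor <;> linarith

/-- Points at Euclidean distance `< 1` from a lattice point are near it. -/
theorem near_of_mem_ball {v : Site 2} {z : ℂ} (hz : dist z (Site.toComplex v) < 1) :
    ∀ k, |coordVec z k - v k| < 1 := fun k => by
  rw [Complex.dist_eq] at hz
  rcases fin_two_eq_zero_or_one k with rfl | rfl
  · simpa using (Complex.abs_re_le_norm _).trans_lt hz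
  · simpa using (Complex.abs_im_le_norm _).trans_lt hz

/-- On the segment from a lattice point `u` to a point `m` of the lattice edge `[u, u + e₀]`,
every point other than `m` is near `u`. -/
theorem near_of_mem_segment_of_ne {u : Site 2} {m z : ℂ}
    (hm : m ∈ segment ℝ (Site.toComplex u) (Site.toComplex (u + Pi.single 0 1)))
    (hz : z ∈ segment ℝ (Site.toComplex u) m) (hzm : z ≠ m) : ∀ k, |coordVec z k - u k| < 1 := by
  rw [← edgeTrace_mk, mem_edgeTrace_single_iff] at hm
  obtain ⟨hoff, hm1, hm2⟩ := hm
  rw [mem_segment_iff_coordVec] at hz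
  obtain ⟨t, ht0, ht1, hc⟩ := hz
  have ht1' : t < 1 := by
    refine lt_of_le_of_ne ht1 fun ht => hzm (eq_of_coordVec_eq fun k => ?_)
    rw [hc k, ht]; ring
  intro k
  rw [hc k, coordVec_toComplex, abs_lt]
  rcases fin_two_eq_zero_or_one k with rfl | rfl
  · constructor <;> nlinarith [mul_nonneg ht0 (sub_nonneg.2 hm1),
      mul_lt_mul_of_pos_right ht1' (by linarith : (0 : ℝ) < coordVec m 0 - u 0 + 1)]
  · rw [hoff 1 (by decide)]
    constructor <;> nlinarith

/-! ### Inner faces of a discretised Jordan domain -/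

/-- Corners of inner faces are sites of `Ω_δ`. -/
theorem mem_meshDomain_of_isCorner_of_isInnerFace {D : DiscreteDobrushin} {v g : Site 2}
    (hg : D.IsInnerFace g) (hv : IsCorner v g) : v ∈ meshDomain D.Ω D.δ := by
  obtain ⟨k, rfl⟩ := exists_faceAt_of_isCorner hv
  exact (discreteDomainGraph_adj_iff.1
    (DiscreteDobrushin.adj_of_isInnerFace_faceAt (k := k) hg (Or.inl rfl))).2.1

variable {Dm : DobrushinDomain} {δ : ℝ}

/-- **The closed square of an inner face lies in `δ⁻¹ • closure D`**: its open square lies in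
`D` (Jordan curve theorem, `mem_carrier_of_mem_openSq`) and its sides are edges of `Ω_δ`. -/
theorem smul_mem_closure_of_mem_closedSq (hδ : 0 < δ) {g : Site 2}
    (hg : (dobrushinData Dm δ).IsInnerFace g) {z : ℂ} (hz : z ∈ closedSq g) :
    δ • z ∈ closure Dm.carrier := by
  have hz' : δ⁻¹ • (δ • z) = z := inv_smul_smul₀ hδ.ne' z
  by_cases ho : z ∈ openSq g
  · exact subset_closure (mem_carrier_of_mem_openSq hδ hg (by rw [hz']; exact ho))
  · simp only [openSq, mem_setOf_eq, not_forall, not_and_or, not_lt] at ho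
    obtain ⟨j, hj⟩ := ho
    obtain ⟨i, hij⟩ := exists_ne j
    obtain ⟨h1, h2⟩ := hz j
    obtain ⟨h3, h4⟩ := hz i
    rcases hj with hj | hj
    · exact mem_closure_of_on_side hδ hg hij.symm (σ := 0) (Nat.zero_le _)
        (by rw [hz']; push_cast; linarith) (by rw [hz']; exact h3) (by rw [hz']; exact h4)
    · exact mem_closure_of_on_side hδ hg hij.symm (σ := 1) le_rfl
        (by rw [hz']; push_cast; linarith) (by rw [hz']; exact h3) (by rw [hz']; exact h4)

/-- Near every mesh point off the domain there is a point of the rescaled exterior (a point off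
`D` is exterior or on the boundary curve, which lies in the closure of the exterior). -/
theorem exists_exterior_near (hδ : 0 < δ) {y : Site 2} (hy : y ∉ meshVertices Dm.carrier δ) :
    ∃ p, δ • p ∉ closure Dm.carrier ∧ dist p (Site.toComplex y) < 1 := by
  have hcl : meshPoint δ y ∈ closure (closure Dm.carrier)ᶜ := by
    by_cases hyc : meshPoint δ y ∈ closure Dm.carrier
    · exact Dm.frontier_subset_closure_exterior' ⟨hyc, by rwa [Dm.isOpen.interior_eq]⟩
    · exact subset_closure hyc
  obtain ⟨p, hp, hd⟩ := Metric.mem_closure_iff.1 hcl δ hδ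
  refine ⟨δ⁻¹ • p, by rwa [smul_inv_smul₀ hδ.ne'], ?_⟩
  rw [meshPoint_eq_smul, dist_comm] at hd
  rwa [← inv_smul_smul₀ hδ.ne' (Site.toComplex y), dist_smul₀, norm_inv, Real.norm_eq_abs,
    abs_of_pos hδ, inv_mul_lt_iff₀ hδ, mul_one]

/-! ### Points off the closed polygon of a cycle of inner faces -/

section Cycle

variable {β : BondConfig (Site 2)} {q : Site 2 × Fin 4} {n : ℕ}

/-- A connector of the cycle lies in the closed square of the face before it or of the face
after it (the two faces across the crossed edge, resp. the common face; cf. stub B1). -/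
theorem cyConn_subset_closedSq_union' (m : ℕ) :
    cyConn β q m ⊆ closedSq (cyF β q m) ∪ closedSq (cyF β q (m + 1)) := by
  intro z hz
  rcases cyConn_cases m hz with ⟨I, J, hJI, -, -, hcol, hside, -, hshape⟩ | ⟨I, J, hJI, -, hshape⟩
  · obtain ⟨-, hzi, hzj1, hzj2⟩ := hshape
    have key : ∀ F : Site 2, F I = cyF β q m I → (F J + 1 = cyV β q m J ∧ coordVec z J ≤ cyV β q m J) ∨
        (F J = cyV β q m J ∧ (cyV β q m J : ℝ) ≤ coordVec z J) → z ∈ closedSq F := by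
      intro F hFI hFJ k
      rcases fin_two_cases_of_ne hJI k with rfl | rfl
      · rw [hFI]; rcases hzi with h' | h' <;> constructor <;> linarith
      · rcases hFJ with ⟨h1, h2⟩ | ⟨h1, h2⟩
        · have h1' : ((F k : ℤ) : ℝ) + 1 = cyV β q m k := by exact_mod_cast h1
          constructor <;> linarith
        · have h1' : ((F k : ℤ) : ℝ) = cyV β q m k := by exact_mod_cast h1
          constructor <;> linarith
    rcases le_total (coordVec z J) (cyV β q m J) with hle | hge
    · rcases hside with ⟨h1, -⟩ | ⟨-, h2⟩
      · exact Or.inl (key _ rfl (Or.inl ⟨h1, hle⟩))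
      · exact Or.inr (key _ hcol.symm (Or.inl ⟨h2, hle⟩))
    · rcases hside with ⟨-, h2⟩ | ⟨h1, -⟩
      · exact Or.inr (key _ hcol.symm (Or.inr ⟨h2, hge⟩))
      · exact Or.inl (key _ rfl (Or.inr ⟨h1, hge⟩))
  · obtain ⟨-, ⟨hzi1, hzi2⟩, hzj⟩ := hshape
    left; intro k
    rcases fin_two_cases_of_ne hJI k with rfl | rfl
    · constructor <;> linarith
    · rcases hzj with h' | h' <;> constructor <;> linarith

/-- **A point off the closed squares of the faces of the cycle is off the polygon** (dart pieces
lie in the open square of their face; the face of the corner `n + 1` is that of the corner `0`). -/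
theorem not_mem_range_cyLoop_of_forall (h : cornerOrbit β q (n + 1) = q) {z : ℂ}
    (hK : ∀ j ≤ n, z ∉ closedSq (cFace (cornerOrbit β q j))) : z ∉ range (cyLoop n h) := by
  have hK' : ∀ m ≤ n + 1, z ∉ closedSq (cyF β q m) := fun m hm => by
    rcases Nat.of_le_succ hm with hm | rfl
    · exact hK m hm
    · rw [show cyF β q (n + 1) = cFace (cornerOrbit β q 0) by rw [cyF, h]; rfl]; exact hK 0 n.zero_le
  refine not_mem_range_cyLoop h (fun j hj hz => hK' j (by omega) fun k => ?_) (fun j hj hz => ?_)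
  · rw [cyDart_eq] at hz
    obtain ⟨h1, h2⟩ := dartSeg_subset_openSq (isCorner_cy j) hz k
    exact ⟨h1.le, h2.le⟩
  · rcases cyConn_subset_closedSq_union' j hz with h' | h'
    · exact hK' j (by omega) h'
    · exact hK' (j + 1) (by omega) h'

variable (hδ : 0 < δ) (h : cornerOrbit β q (n + 1) = q)
  (hin : ∀ j ≤ n, (dobrushinData Dm δ).IsInnerFace (cFace (cornerOrbit β q j)))
include hin

/-- The open square of a non-inner face is off the polygon. -/
theorem not_mem_range_cyLoop_of_mem_openSq {hf : Site 2}
    (hhf : ¬ (dobrushinData Dm δ).IsInnerFace hf) {z : ℂ} (hz : z ∈ openSq hf) :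
    z ∉ range (cyLoop n h) :=
  not_mem_range_cyLoop_of_forall h fun j hj hzj =>
    hhf (eq_of_mem_openSq_of_mem_closedSq hz hzj ▸ hin j hj)

/-- Points near a lattice point outside `Ω_δ` are off the polygon. -/
theorem not_mem_range_cyLoop_of_near {v : Site 2} (hv : v ∉ meshDomain Dm.carrier δ) {z : ℂ}
    (hnear : ∀ k, |coordVec z k - v k| < 1) : z ∉ range (cyLoop n h) :=
  not_mem_range_cyLoop_of_forall h fun j hj hzj =>
    hv (mem_meshDomain_of_isCorner_of_isInnerFace (hin j hj) (isCorner_of_mem_closedSq_of_near hzj hnear))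

include hδ

/-- Points of the rescaled exterior are off the polygon. -/
theorem not_mem_range_cyLoop_of_exterior {z : ℂ} (hz : δ • z ∉ closure Dm.carrier) :
    z ∉ range (cyLoop n h) :=
  not_mem_range_cyLoop_of_forall h fun j hj hzj => hz (smul_mem_closure_of_mem_closedSq hδ (hin j hj) hzj)

omit hδ hin in
/-- Points joined by a segment off the polygon lie in the same complementary component. -/
theorem mem_connectedComponentIn_of_segment {x a b : ℂ}
    (ha : a ∈ connectedComponentIn (range (cyLoop n h))ᶜ x)
    (hab : ∀ z ∈ segment ℝ a b, z ∉ range (cyLoop n h)) :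
    b ∈ connectedComponentIn (range (cyLoop n h))ᶜ x := by
  rw [connectedComponentIn_eq ha]
  exact (convex_segment a b).isPreconnected.subset_connectedComponentIn (left_mem_segment ℝ a b)
    (fun z hz hz' => hab z hz hz') (right_mem_segment ℝ a b)

/-- **The winding number vanishes on the complementary component of a rescaled exterior point**:
the rescaled exterior `δ⁻¹ • (closure D)ᶜ` is preconnected (Jordan curve theorem), off the
polygon and unbounded, and so is then the component (`wind_sub_eq_zero_of_not_isBounded`). -/
theorem wind_cyLoop_eq_zero_of_exterior {x m : ℂ} (hm : m ∈ connectedComponentIn (range (cyLoop n h))ᶜ x)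
    (hmX : δ • m ∉ closure Dm.carrier) : wind (fun t => (cyLoop n h).extend t - x) = 0 := by
  set γ := cyLoop (β := β) (q := q) n h with hγ
  set X : Set ℂ := (closure Dm.carrier)ᶜ with hX
  have hX'C : δ⁻¹ • X ⊆ connectedComponentIn (range γ)ᶜ x := by
    rw [connectedComponentIn_eq hm]
    refine IsPreconnected.subset_connectedComponentIn ?_ ((Set.mem_inv_smul_set_iff₀ hδ.ne' _ _).2 hmX)
      fun z hz hzγ => not_mem_range_cyLoop_of_exterior hδ h hin ((Set.mem_inv_smul_set_iff₀ hδ.ne' _ _).1 hz) hzγ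
    rw [← Set.image_smul]
    exact Dm.isConnected_exterior.isPreconnected.image _ (continuous_const_smul δ⁻¹).continuousOn
  have hXunb : ¬ Bornology.IsBounded (δ⁻¹ • X) := by
    intro hb
    have hb' : Bornology.IsBounded X := by
      have := hb.smul₀ δ
      rwa [smul_inv_smul₀ hδ.ne'] at this
    refine NormedSpace.unbounded_univ ℝ ℂ ?_
    rw [← union_compl_self (closure Dm.carrier)]
    exact Dm.isBounded.closure.union hb'
  refine wind_sub_eq_zero_of_not_isBounded γ.continuous_extend.continuousOn
    (by rw [γ.extend_zero, γ.extend_one]) fun hb => hXunb ((hb.subset (connectedComponentIn_mono x ?_)).subset hX'C)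
  rw [compl_subset_compl]
  rintro _ ⟨t, ht, rfl⟩
  rw [γ.extend_apply ht]
  exact mem_range_self _

/-- **Walking east from a lattice point outside `Ω_δ` to the exterior, off the polygon.** If
`v ∉ Ω_δ` lies in the complementary component of `x`, the winding number about `x` vanishes: the
lattice points `v + s e₀` stay outside `Ω_δ` (one mesh component) as long as consecutive ones are
mesh vertices joined by mesh edges, which fails for some `s` (finitely many mesh vertices); there
the mesh point is off `D`, or the next lattice edge leaves `closure D`, near an exterior point. -/
theorem wind_cyLoop_eq_zero_of_not_mem_meshDomain {x : ℂ} {v : Site 2} (hv : v ∉ meshDomain Dm.carrier δ)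
    (hvx : Site.toComplex v ∈ connectedComponentIn (range (cyLoop n h))ᶜ x) :
    wind (fun t => (cyLoop n h).extend t - x) = 0 := by
  classical
  set u : ℕ → Site 2 := fun s => v + (s : ℤ) • Pi.single 0 1 with hu
  have hu0 : u 0 = v := by simp [hu]
  have husucc : ∀ s, u (s + 1) = u s + Pi.single 0 1 := fun s => by
    simp only [hu, Nat.cast_succ, add_smul, one_smul, add_assoc]
  -- the first failure of "mesh vertex joined to the next lattice point by a mesh edge"
  have hex : ∃ s, ¬ (u s ∈ meshVertices Dm.carrier δ ∧ (meshGraph Dm.carrier δ).Adj (u s) (u (s + 1))) := by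
    by_contra hall
    push Not at hall
    have hinj : Function.Injective u := fun s s' hss' => by simpa [hu] using congr_fun hss' 0
    exact Set.infinite_range_of_injective hinj
      ((meshVertices_finite Dm.isBounded hδ).subset (Set.range_subset_iff.2 fun s => (hall s).1))
  have hgood : ∀ s < Nat.find hex, u s ∈ meshVertices Dm.carrier δ ∧
      (meshGraph Dm.carrier δ).Adj (u s) (u (s + 1)) := fun s hs => not_not.1 (Nat.find_min hex hs)
  -- the walk stays outside `Ω_δ` and in the component of `x`
  have hwalk : ∀ s ≤ Nat.find hex, u s ∉ meshDomain Dm.carrier δ ∧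
      Site.toComplex (u s) ∈ connectedComponentIn (range (cyLoop n h))ᶜ x := by
    intro s hs
    induction s with
    | zero => rw [hu0]; exact ⟨hv, hvx⟩
    | succ s ih =>
      obtain ⟨hsD, hsx⟩ := ih (Nat.le_of_succ_le hs)
      obtain ⟨hvert, hadj⟩ := hgood s (Nat.lt_of_succ_le hs)
      have hs1D : u (s + 1) ∉ meshDomain Dm.carrier δ := fun hmem =>
        hsD (mem_meshDomain_of_meshGraph_adj hmem hvert hadj.symm)
      refine ⟨hs1D, mem_connectedComponentIn_of_segment h hsx fun z hz => ?_⟩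
      by_cases hzm : z = Site.toComplex (u (s + 1))
      · exact hzm ▸ not_mem_range_cyLoop_of_near h hin hs1D fun k => by simp
      · exact not_mem_range_cyLoop_of_near h hin hsD
          (near_of_mem_segment_of_ne (by rw [husucc]; exact right_mem_segment ℝ _ _) hz hzm)
  obtain ⟨htD, hut⟩ := hwalk (Nat.find hex) le_rfl
  rcases not_and_or.1 (Nat.find_spec hex) with hbad | hbad
  · -- the mesh point is off `D`: an exterior point at distance `< 1` (lattice units)
    obtain ⟨m, hmX, hmd⟩ := exists_exterior_near hδ hbad
    exact wind_cyLoop_eq_zero_of_exterior hδ h hin (mem_connectedComponentIn_of_segment h hut fun z hz =>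
      not_mem_range_cyLoop_of_near h hin htD (near_of_mem_segment (fun k => by simp) (near_of_mem_ball hmd) hz)) hmX
  · -- the next lattice edge leaves `closure D`
    have hseg : ¬ segment ℝ (meshPoint δ (u (Nat.find hex))) (meshPoint δ (u (Nat.find hex + 1))) ⊆
        closure Dm.carrier := fun H =>
      hbad (meshGraph_adj_iff.2 ⟨by rw [husucc]; exact (zdGraph_adj_iff _ _).2 ⟨0, Or.inl rfl⟩, H⟩)
    obtain ⟨p, hp, hpX⟩ := not_subset.1 hseg
    rw [meshPoint_eq_smul, meshPoint_eq_smul, mem_segment_smul_iff hδ.ne', husucc] at hp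
    refine wind_cyLoop_eq_zero_of_exterior hδ h hin (m := δ⁻¹ • p)
      (mem_connectedComponentIn_of_segment h hut fun z hz => ?_) (by rwa [smul_inv_smul₀ hδ.ne'])
    by_cases hzm : z = δ⁻¹ • p
    · exact hzm ▸ not_mem_range_cyLoop_of_exterior hδ h hin (by rwa [smul_inv_smul₀ hδ.ne'])
    · exact not_mem_range_cyLoop_of_near h hin htD (near_of_mem_segment_of_ne hp hz hzm)

/-- **Stub B at fixed data.** A side `[v, w]` of the non-inner face `hf` is not an edge of `Ω_δ`:
if an endpoint is outside `Ω_δ`, walk to it from the centre and apply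
`wind_cyLoop_eq_zero_of_not_mem_meshDomain`; otherwise the side leaves `closure D` at a point
joined to the centre through the open square of `hf`. -/
theorem wind_cyLoop_faceCenter_eq_zero {hf : Site 2} (hhf : ¬ (dobrushinData Dm δ).IsInnerFace hf) :
    wind (fun t => (cyLoop n h).extend t - faceCenter hf) = 0 := by
  have hc0 : faceCenter hf ∈ connectedComponentIn (range (cyLoop n h))ᶜ (faceCenter hf) :=
    mem_connectedComponentIn (not_mem_range_cyLoop h (fun j _ => faceCenter_not_mem_cyDart _ _)
      (fun j _ => faceCenter_not_mem_cyConn _ _))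
  have hhf' := hhf
  simp only [DiscreteDobrushin.IsInnerFace, dobrushinData_Ω, dobrushinData_δ, not_forall, exists_prop] at hhf
  obtain ⟨v, w, hv, hw, hvw, hnadj⟩ := hhf
  -- an endpoint outside `Ω_δ`
  have case_out : ∀ u, IsCorner u hf → u ∉ meshDomain Dm.carrier δ →
      wind (fun t => (cyLoop n h).extend t - faceCenter hf) = 0 := fun u hu huD =>
    wind_cyLoop_eq_zero_of_not_mem_meshDomain hδ h hin huD (mem_connectedComponentIn_of_segment h hc0 fun z hz =>
      not_mem_range_cyLoop_of_near h hin huD (near_of_mem_segment (near_faceCenter hu) (fun k => by simp) hz))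
  by_cases hvD : v ∈ meshDomain Dm.carrier δ
  swap; · exact case_out v hv hvD
  by_cases hwD : w ∈ meshDomain Dm.carrier δ
  swap; · exact case_out w hw hwD
  -- both endpoints in `Ω_δ`: the side leaves `closure D`
  have hseg : ¬ segment ℝ (meshPoint δ v) (meshPoint δ w) ⊆ closure Dm.carrier := fun H =>
    hnadj (discreteDomainGraph_adj_iff.2 ⟨meshGraph_adj_iff.2 ⟨hvw, H⟩, hvD, hwD⟩)
  obtain ⟨p, hp, hpX⟩ := not_subset.1 hseg
  rw [meshPoint_eq_smul, meshPoint_eq_smul, mem_segment_smul_iff hδ.ne'] at hp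
  have hm : δ⁻¹ • p ∈ closedSq hf :=
    (convex_closedSq hf).segment_subset (toComplex_mem_closedSq hv) (toComplex_mem_closedSq hw) hp
  refine wind_cyLoop_eq_zero_of_exterior hδ h hin (m := δ⁻¹ • p)
    (mem_connectedComponentIn_of_segment h hc0 fun z hz => ?_) (by rwa [smul_inv_smul₀ hδ.ne'])
  by_cases hzm : z = δ⁻¹ • p
  · exact hzm ▸ not_mem_range_cyLoop_of_exterior hδ h hin (by rwa [smul_inv_smul₀ hδ.ne'])
  · exact not_mem_range_cyLoop_of_mem_openSq h hin hhf' (mem_openSq_of_mem_segment_faceCenter hm hz hzm)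

end Cycle

/-- **B: for a cycle through inner faces of a discretised Jordan domain, every non-inner face
centre has winding number zero.** -/
theorem stub_touch_wind_faceCenter_eq_zero_of_not_isInnerFace :
    ∀ (Dm : DobrushinDomain) (E : DiscreteDobrushin), E.Ω = Dm.carrier → 0 < E.δ →
      ∀ (β : BondConfig (Site 2)), β ⊆ (discreteDomainGraph E.Ω E.δ).edgeSet →
      ∀ (q : Site 2 × Fin 4) (n : ℕ) (h : cornerOrbit β q (n + 1) = q),
      (∀ j ≤ n, E.IsInnerFace (cFace (cornerOrbit β q j))) →
      ∀ hf : Site 2, ¬ E.IsInnerFace hf →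
      wind (fun t => (cyLoop n h).extend t - faceCenter hf) = 0 := by
  intro Dm E hΩ hδ β _ q n h hin hf hhf
  obtain ⟨Ω', δ, A', B'⟩ := E
  cases hΩ
  exact wind_cyLoop_faceCenter_eq_zero hδ h hin hhf

end Summit.CriticalPhenomena.CardyFormulaZ2.Cruxes.LagHandOff.HittingTournament

end
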